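import Literature.Computability.QuantumComplexity.SolovayKitaev.BalancedCommutator
import Literature.Computability.QuantumComplexity.SolovayKitaev.Net
import HarnessLib

/-!
# Solovay–Kitaev theorem: the recursion and the polylogarithmic word length

Proof infrastructure for the discharge of
`Literature.Computability.QuantumComplexity.solovay_kitaev` (Dawson–Nielsen, *The Solovay–Kitaev
algorithm*, QIC **6** (2006), Theorem 1).  This file runs the recursion of Dawson–Nielsen §3/§5.1
and its analysis:

* `shrink` — one level of the recursion ("Return `U_n = V_{n-1} W_{n-1} V_{n-1}† W_{n-1}† U_{n-1}`",
  DN §3 with Lemma 1 and §5.2): if every element of `SU(n)` has a word of length `≤ L` within `δ`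
  (`δ` below an explicit threshold), then every element has a word of length `≤ 5L` within
  `K δ^{3/2}`, `K = 120|n|⁶ + 32|n|² + 14`;
* `stage` — iterating from an `ε₀`-net (`exists_length_forall_wordApprox`): words of length
  `≤ 5^k l₀` and accuracy `ε_k`, `ε_{k+1} = K ε_k^{3/2}` (DN eq. (4)–(5));
* `decay` — `ε_k ≤ K⁻² exp(-(3/2)^k log(1/(K²ε₀)))` (DN eq. (7));
* `exists_consts_length_le_log_rpow` — choosing the depth `k` for a target accuracy `ε`
  (DN eq. (9)) gives words of length `O(log^{log 5/log(3/2)}(1/ε))` (DN eq. (10)), uniformly for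
  `ε ∈ (0, 1/2]`; this is exactly the body of `solovay_kitaev`.

No definitions and no new statements are introduced; everything is proved.
-/

noncomputable section

open scoped Matrix.Norms.L2Operator

namespace Literature.Computability.QuantumComplexity.SolovayKitaev

open Matrix

variable {n : Type*} [Fintype n] [DecidableEq n]
variable {G : Set (Matrix.specialUnitaryGroup n ℂ)}

/-! ### Two more closure properties of `WordApprox` -/

/-- A word approximating `X` within `δ` approximates any `Y` with `‖X - Y‖ ≤ δ'` within `δ + δ'`.
[folklore] -/
theorem WordApprox.of_norm_sub_le {L : ℕ} {δ δ' : ℝ} {X Y : Matrix.specialUnitaryGroup n ℂ}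
    (h : WordApprox G L δ X) (hXY : ‖(X : Matrix n n ℂ) - (Y : Matrix n n ℂ)‖ ≤ δ') :
    WordApprox G L (δ + δ') Y := by
  obtain ⟨w, hw, hl, hd⟩ := h
  refine ⟨w, hw, hl, ?_⟩
  calc ‖((w.prod : Matrix.specialUnitaryGroup n ℂ) : Matrix n n ℂ) - (Y : Matrix n n ℂ)‖
      = ‖(((w.prod : Matrix.specialUnitaryGroup n ℂ) : Matrix n n ℂ) - (X : Matrix n n ℂ)) +
          ((X : Matrix n n ℂ) - (Y : Matrix n n ℂ))‖ := by congr 1; abel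
    _ ≤ _ := norm_add_le _ _
    _ ≤ δ + δ' := add_le_add hd hXY

/-- A word computes its own product exactly. [folklore] -/
theorem WordApprox.self {w : List (Matrix.specialUnitaryGroup n ℂ)} (hw : ∀ g ∈ w, g ∈ G) {L : ℕ}
    (hl : w.length ≤ L) : WordApprox G L 0 w.prod :=
  ⟨w, hw, hl, by simp⟩

/-! ### One level of the recursion -/

/-- **The shrinking step** (Dawson–Nielsen 2006 §3 and §5.1: `ε_n = c_approx ε_{n-1}^{3/2}`,
`l_n = 5 l_{n-1}`).  If `G ⊆ SU(n)` is inverse-closed and every `U ∈ SU(n)` has a word of length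
`≤ L` within `δ`, where `2|n|⁴δ ≤ 1` and `δ ≤ 1`, then every `U` has a word of length `≤ 5L`
within `(120|n|⁶ + 32|n|² + 14) δ√δ`: approximate `U` by `U₀`, decompose `U U₀⁻¹` as a balanced
commutator `≈ VWV⁻¹W⁻¹` (`exists_balanced_commutator`) and use the words for `V, W`
(`WordApprox.comm`, Dawson–Nielsen Lemma 1). [cite: DawsonNielsen2006, §3] -/
theorem shrink (hinv : ∀ g ∈ G, g⁻¹ ∈ G) {L : ℕ} {δ : ℝ}
    (h : ∀ U : Matrix.specialUnitaryGroup n ℂ, WordApprox G L δ U)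
    (hδ : 2 * (Fintype.card n : ℝ) ^ 4 * δ ≤ 1) (hδ1 : δ ≤ 1) (U : Matrix.specialUnitaryGroup n ℂ) :
    WordApprox G (5 * L)
      ((120 * (Fintype.card n : ℝ) ^ 6 + 32 * (Fintype.card n : ℝ) ^ 2 + 14) * δ * Real.sqrt δ) U := by
  obtain ⟨w₀, hw₀, hl₀, hd₀⟩ := h U
  have hδ0 : 0 ≤ δ := (norm_nonneg _).trans hd₀
  set P₀ : Matrix.specialUnitaryGroup n ℂ := w₀.prod with hP₀
  -- `Δ = U P₀⁻¹` is within `δ` of `1`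
  have hΔ : ‖((U * P₀⁻¹ : Matrix.specialUnitaryGroup n ℂ) : Matrix n n ℂ) - 1‖ ≤ δ := by
    have hrw : ((U * P₀⁻¹ : Matrix.specialUnitaryGroup n ℂ) : Matrix n n ℂ) - 1 =
        ((U : Matrix n n ℂ) - (P₀ : Matrix n n ℂ)) *
          ((P₀⁻¹ : Matrix.specialUnitaryGroup n ℂ) : Matrix n n ℂ) := by
      rw [Matrix.sub_mul, ← Submonoid.coe_mul, ← Submonoid.coe_mul, mul_inv_cancel,
        Submonoid.coe_one]
    rw [hrw, norm_mul_coe, norm_sub_rev]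
    exact hd₀
  obtain ⟨V, W, hV1, hW1, hcomm⟩ := exists_balanced_commutator (U * P₀⁻¹) hΔ hδ
  -- the commutator word and the word for `P₀`
  have hc := WordApprox.comm hinv (h V) (h W) hV1 hW1
  have hΔw := hc.of_norm_sub_le hcomm
  have hP : WordApprox G L 0 P₀ := WordApprox.self hw₀ hl₀
  have hU := hΔw.mul hP
  rw [inv_mul_cancel_right] at hU
  refine hU.mono (by omega) ?_
  -- `16 (2|n|²√δ) δ + 14 δ² + 120|n|⁶ δ√δ + 0 ≤ (120|n|⁶ + 32|n|² + 14) δ√δ`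
  have hsq : δ ^ 2 ≤ δ * Real.sqrt δ := by
    have h1 : δ ≤ Real.sqrt δ := by
      rw [Real.le_sqrt hδ0 hδ0]
      nlinarith
    nlinarith
  nlinarith [sq_nonneg (Fintype.card n : ℝ), hsq]

/-! ### Iterating: stages of the recursion -/

/-- **The stages** (Dawson–Nielsen 2006 §3, eq. (4)–(5)): starting from an `ε₀`-net of words of
length `≤ l₀` with `ε₀` below the thresholds, after `k` levels every `U ∈ SU(n)` has a word of
length `≤ 5^k l₀` within `ε_k`, where `ε_{k+1} = K ε_k √ε_k`, `K = 120|n|⁶ + 32|n|² + 14`; and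
`0 ≤ ε_k ≤ ε₀`. [cite: DawsonNielsen2006, §3] -/
theorem stage (hinv : ∀ g ∈ G, g⁻¹ ∈ G) {l₀ : ℕ} {ε₀ : ℝ}
    (h0 : ∀ U : Matrix.specialUnitaryGroup n ℂ, WordApprox G l₀ ε₀ U)
    (hε₀ : 2 * (Fintype.card n : ℝ) ^ 4 * ε₀ ≤ 1) (hε₀1 : ε₀ ≤ 1)
    (hε₀K : (120 * (Fintype.card n : ℝ) ^ 6 + 32 * (Fintype.card n : ℝ) ^ 2 + 14) ^ 2 * ε₀ ≤ 1)
    (e : ℕ → ℝ) (he0 : e 0 = ε₀)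
    (hes : ∀ k, e (k + 1) =
      (120 * (Fintype.card n : ℝ) ^ 6 + 32 * (Fintype.card n : ℝ) ^ 2 + 14) * e k * Real.sqrt (e k))
    (k : ℕ) :
    (0 ≤ e k ∧ e k ≤ ε₀) ∧
      ∀ U : Matrix.specialUnitaryGroup n ℂ, WordApprox G (5 ^ k * l₀) (e k) U := by
  set K : ℝ := 120 * (Fintype.card n : ℝ) ^ 6 + 32 * (Fintype.card n : ℝ) ^ 2 + 14 with hK
  have hK0 : 0 < K := by positivity
  induction k with
  | zero =>
    refine ⟨⟨?_, by rw [he0]⟩, fun U => ?_⟩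
    · rw [he0]
      exact (h0 1).nonneg
    · rw [pow_zero, one_mul, he0]; exact h0 U
  | succ k ih =>
    obtain ⟨⟨hek0, hekε⟩, hk⟩ := ih
    have hekd : 2 * (Fintype.card n : ℝ) ^ 4 * e k ≤ 1 :=
      le_trans (by gcongr) hε₀
    have hek1 : e k ≤ 1 := hekε.trans hε₀1
    have hnext : ∀ U : Matrix.specialUnitaryGroup n ℂ,
        WordApprox G (5 * (5 ^ k * l₀)) (K * e k * Real.sqrt (e k)) U :=
      shrink hinv hk hekd hek1
    refine ⟨⟨?_, ?_⟩, fun U => ?_⟩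
    · rw [hes]; positivity
    · -- `K e_k √e_k ≤ e_k` since `K √e_k ≤ √(K² ε₀) ≤ 1`
      rw [hes]
      have h1 : K * Real.sqrt (e k) ≤ 1 := by
        have h2 : K * Real.sqrt (e k) = Real.sqrt (K ^ 2 * e k) := by
          rw [Real.sqrt_mul' _ hek0, Real.sqrt_sq hK0.le]
        rw [h2, Real.sqrt_le_one]
        exact le_trans (by gcongr) hε₀K
      calc K * e k * Real.sqrt (e k) = (K * Real.sqrt (e k)) * e k := by ring
        _ ≤ 1 * e k := by gcongr
        _ = e k := one_mul _
        _ ≤ ε₀ := hekε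
    · rw [pow_succ, hes]
      have := hnext U
      rwa [show 5 * (5 ^ k * l₀) = 5 ^ k * 5 * l₀ by ring] at this

/-- **The decay of the accuracies** (Dawson–Nielsen 2006 §3, eq. (7):
`ε_k = (ε₀ c²)^{(3/2)^k} / c²`), in inequality form: `ε_k ≤ K⁻² exp(-(3/2)^k log(1/(K² ε₀)))`.
[cite: DawsonNielsen2006, §3] -/
theorem decay {K ε₀ : ℝ} (hK : 0 < K) (hε₀ : 0 < ε₀) (e : ℕ → ℝ) (he0 : e 0 = ε₀)
    (hes : ∀ k, e (k + 1) = K * e k * Real.sqrt (e k)) (k : ℕ) :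
    e k ≤ (K ^ 2)⁻¹ * Real.exp (-((3 / 2 : ℝ) ^ k * Real.log (1 / (K ^ 2 * ε₀)))) := by
  set L₀ : ℝ := Real.log (1 / (K ^ 2 * ε₀)) with hL₀
  have hK2 : 0 < K ^ 2 := by positivity
  induction k with
  | zero =>
    rw [he0, pow_zero, one_mul, hL₀, one_div, Real.log_inv, neg_neg, Real.exp_log (by positivity)]
    rw [← mul_assoc, inv_mul_cancel₀ hK2.ne', one_mul]
  | succ k ih =>
    set M : ℝ := (K ^ 2)⁻¹ * Real.exp (-((3 / 2 : ℝ) ^ k * L₀)) with hM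
    have hM0 : 0 ≤ M := by positivity
    have hsqM : Real.sqrt M = K⁻¹ * Real.exp (-((3 / 2 : ℝ) ^ k * L₀) / 2) := by
      rw [Real.sqrt_eq_iff_mul_self_eq hM0 (by positivity), hM]
      rw [show K⁻¹ * Real.exp (-((3 / 2 : ℝ) ^ k * L₀) / 2) * (K⁻¹ * Real.exp (-((3 / 2 : ℝ) ^ k * L₀) / 2))
          = (K⁻¹ * K⁻¹) * (Real.exp (-((3 / 2 : ℝ) ^ k * L₀) / 2) *
              Real.exp (-((3 / 2 : ℝ) ^ k * L₀) / 2)) by ring, ← Real.exp_add]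
      congr 1
      · ring
      · congr 1; ring
    rw [hes]
    calc K * e k * Real.sqrt (e k) ≤ K * M * Real.sqrt M := by
          have h1 : Real.sqrt (e k) ≤ Real.sqrt M := Real.sqrt_le_sqrt ih
          have h2 : 0 ≤ Real.sqrt (e k) := Real.sqrt_nonneg _
          gcongr
      _ = (K ^ 2)⁻¹ * Real.exp (-((3 / 2 : ℝ) ^ (k + 1) * L₀)) := by
          rw [hsqM, hM]
          rw [show K * ((K ^ 2)⁻¹ * Real.exp (-((3 / 2 : ℝ) ^ k * L₀))) *
              (K⁻¹ * Real.exp (-((3 / 2 : ℝ) ^ k * L₀) / 2)) =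
              (K * K⁻¹) * (K ^ 2)⁻¹ * (Real.exp (-((3 / 2 : ℝ) ^ k * L₀)) *
                Real.exp (-((3 / 2 : ℝ) ^ k * L₀) / 2)) by ring,
            mul_inv_cancel₀ hK.ne', one_mul, ← Real.exp_add]
          congr 2
          rw [pow_succ]
          ring

/-! ### The polylogarithmic length bound -/

/-- **Solovay–Kitaev, quantitative core** (Dawson–Nielsen 2006 Thm 1 with the analysis of §3,
eq. (9)–(10)): if `G ⊆ SU(n)` is closed under inverses and generates a dense subgroup, there are
`C, c > 0` (`c = log 5 / log (3/2) ≈ 3.97`) such that every `U ∈ SU(n)` is within any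
`ε ∈ (0, 1/2]` of a word over `G` of length `≤ C log(1/ε)^c`. [cite: DawsonNielsen2006, Theorem 1] -/
theorem exists_consts_length_le_log_rpow (hinv : ∀ g ∈ G, g⁻¹ ∈ G)
    (hdense : Dense (Subgroup.closure G : Set (Matrix.specialUnitaryGroup n ℂ))) :
    ∃ C c : ℝ, 0 < C ∧ 0 < c ∧ ∀ ε : ℝ, 0 < ε → ε ≤ 1 / 2 →
      ∀ U : Matrix.specialUnitaryGroup n ℂ,
        ∃ w : List (Matrix.specialUnitaryGroup n ℂ), (∀ g ∈ w, g ∈ G) ∧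
          (w.length : ℝ) ≤ C * Real.log (1 / ε) ^ c ∧
          ‖(w.prod : Matrix n n ℂ) - (U : Matrix n n ℂ)‖ ≤ ε := by
  -- constants
  set d : ℝ := (Fintype.card n : ℝ) with hd
  have hd0 : (0 : ℝ) ≤ d := by rw [hd]; exact Nat.cast_nonneg _
  set K : ℝ := 120 * d ^ 6 + 32 * d ^ 2 + 14 with hK
  have hK1 : 1 ≤ K := by rw [hK]; nlinarith [pow_nonneg hd0 6, pow_nonneg hd0 2]
  have hK0 : 0 < K := by linarith
  set D : ℝ := d ^ 4 + 1 with hD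
  have hD1 : 1 ≤ D := by rw [hD]; nlinarith [pow_nonneg hd0 4]
  have hDpos : 0 < D := by linarith
  have hDne : D ≠ 0 := hDpos.ne'
  have hKne : K ≠ 0 := hK0.ne'
  set ε₀ : ℝ := 1 / (4 * K ^ 2 * D) with hε₀
  have hε₀0 : 0 < ε₀ := by positivity
  have hKε₀ : K ^ 2 * ε₀ = 1 / (4 * D) := by
    rw [hε₀, eq_div_iff (by positivity)]
    field_simp
  have hε₀K : K ^ 2 * ε₀ ≤ 1 := by
    rw [hKε₀, div_le_one (by positivity)]; linarith
  have hε₀1 : ε₀ ≤ 1 := by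
    calc ε₀ = 1 * ε₀ := (one_mul _).symm
      _ ≤ K ^ 2 * ε₀ := by gcongr; nlinarith
      _ ≤ 1 := hε₀K
  have hε₀d : 2 * d ^ 4 * ε₀ ≤ 1 := by
    have h1 : 2 * d ^ 4 * ε₀ ≤ 2 * D * ε₀ := by gcongr; linarith
    have h2 : 2 * D * ε₀ = 1 / (2 * K ^ 2) := by rw [hε₀]; field_simp; ring
    rw [h2] at h1
    refine h1.trans ?_
    rw [div_le_one (by positivity)]; nlinarith
  -- the initial net and the stages
  obtain ⟨l₀, hl₀⟩ := exists_length_forall_wordApprox hinv hdense hε₀0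
  let e : ℕ → ℝ := fun k => Nat.rec ε₀ (fun _ x => K * x * Real.sqrt x) k
  have he0 : e 0 = ε₀ := rfl
  have hes : ∀ k, e (k + 1) = K * e k * Real.sqrt (e k) := fun k => rfl
  have hstage := stage hinv hl₀ hε₀d hε₀1 hε₀K e he0 hes
  have hdecay := decay hK0 hε₀0 e he0 hes
  set L₀ : ℝ := Real.log (1 / (K ^ 2 * ε₀)) with hL₀
  have hL₀pos : 0 < L₀ := by
    rw [hL₀, hKε₀, one_div_one_div]
    exact Real.log_pos (by linarith)
  -- exponents and constants of the final bound
  set c : ℝ := Real.logb (3 / 2) 5 with hc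
  have hcpos : 0 < c := Real.logb_pos (by norm_num) (by norm_num)
  have h5 : (3 / 2 : ℝ) ^ c = 5 := Real.rpow_logb (by norm_num) (by norm_num) (by norm_num)
  have hlog2 : 0 < Real.log 2 := Real.log_pos (by norm_num)
  set B : ℝ := 1 / Real.log 2 + (3 / 2) / L₀ with hB
  have hB0 : 0 < B := by positivity
  refine ⟨((l₀ : ℝ) + 1) * B ^ c, c, by positivity, hcpos, fun ε hε hε2 U => ?_⟩
  -- choose the depth `k`: the least `k` with `L ≤ (3/2)^k L₀`, `L = log (1/(K² ε))`
  set L : ℝ := Real.log (1 / (K ^ 2 * ε)) with hL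
  have hex : ∃ k : ℕ, L ≤ (3 / 2 : ℝ) ^ k * L₀ := by
    obtain ⟨k, hk⟩ := pow_unbounded_of_one_lt (L / L₀) (by norm_num : (1 : ℝ) < 3 / 2)
    exact ⟨k, by rw [div_lt_iff₀ hL₀pos] at hk; exact hk.le⟩
  classical
  set k : ℕ := Nat.find hex with hk
  have hkspec : L ≤ (3 / 2 : ℝ) ^ k * L₀ := Nat.find_spec hex
  -- accuracy: `e k ≤ ε`
  have hek : e k ≤ ε := by
    refine (hdecay k).trans ?_
    have hKε : 0 < K ^ 2 * ε := by positivity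
    calc (K ^ 2)⁻¹ * Real.exp (-((3 / 2 : ℝ) ^ k * L₀)) ≤ (K ^ 2)⁻¹ * Real.exp (-L) := by
          gcongr
      _ = ε := by
          rw [hL, one_div, Real.log_inv, neg_neg, Real.exp_log hKε, ← mul_assoc,
            inv_mul_cancel₀ (by positivity), one_mul]
  -- the word
  obtain ⟨w, hw, hwl, hwd⟩ := (hstage k).2 U
  refine ⟨w, hw, ?_, hwd.trans hek⟩
  -- length: `5^k = ((3/2)^k)^c` and `(3/2)^k ≤ B log(1/ε)`
  have hlogε : Real.log 2 ≤ Real.log (1 / ε) := by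
    apply Real.log_le_log (by norm_num)
    rw [le_one_div (by norm_num) hε]; linarith
  have hlogε0 : 0 < Real.log (1 / ε) := hlog2.trans_le hlogε
  have hLle : L ≤ Real.log (1 / ε) := by
    rw [hL]
    apply Real.log_le_log (by positivity)
    rw [one_div_le_one_div (by positivity) hε]
    exact le_mul_of_one_le_left hε.le (one_le_pow₀ hK1)
  have hx : (3 / 2 : ℝ) ^ k ≤ B * Real.log (1 / ε) := by
    have hx1 : (3 / 2 : ℝ) ^ k ≤ 1 + (3 / 2) * Real.log (1 / ε) / L₀ := by
      rcases Nat.eq_zero_or_pos k with h0 | hpos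
      · rw [h0, pow_zero]
        have : 0 ≤ (3 / 2) * Real.log (1 / ε) / L₀ := by positivity
        linarith
      · obtain ⟨j, hj⟩ := Nat.exists_eq_add_of_lt hpos
        have hjk : j < k := by omega
        have hmin : ¬ (L ≤ (3 / 2 : ℝ) ^ j * L₀) := Nat.find_min hex (by rw [← hk]; exact hjk)
        push Not at hmin
        have hkj : k = j + 1 := by omega
        rw [hkj, pow_succ]
        have h1 : (3 / 2 : ℝ) ^ j < L / L₀ := by rw [lt_div_iff₀ hL₀pos]; exact hmin
        have h2 : L / L₀ ≤ Real.log (1 / ε) / L₀ := div_le_div_of_nonneg_right hLle hL₀pos.le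
        have h3 : (3 / 2 : ℝ) ^ j * (3 / 2) ≤ (3 / 2) * (Real.log (1 / ε) / L₀) := by
          rw [mul_comm]
          exact mul_le_mul_of_nonneg_left (h1.le.trans h2) (by norm_num)
        have h4 : (3 / 2 : ℝ) * (Real.log (1 / ε) / L₀) = 3 / 2 * Real.log (1 / ε) / L₀ := by
          ring
        rw [h4] at h3
        linarith
    have hx2 : (1 : ℝ) ≤ Real.log (1 / ε) / Real.log 2 := by rwa [le_div_iff₀ hlog2, one_mul]
    calc (3 / 2 : ℝ) ^ k ≤ 1 + (3 / 2) * Real.log (1 / ε) / L₀ := hx1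
      _ ≤ Real.log (1 / ε) / Real.log 2 + (3 / 2) * Real.log (1 / ε) / L₀ := by linarith
      _ = B * Real.log (1 / ε) := by rw [hB]; ring
  have h5k : ((5 : ℕ) ^ k : ℕ) = (((3 / 2 : ℝ) ^ k) ^ c : ℝ) := by
    push_cast
    rw [← h5, ← Real.rpow_natCast, ← Real.rpow_mul (by norm_num), mul_comm, Real.rpow_mul (by norm_num),
      Real.rpow_natCast]
  calc (w.length : ℝ) ≤ ((5 ^ k * l₀ : ℕ) : ℝ) := by exact_mod_cast hwl
    _ = ((3 / 2 : ℝ) ^ k) ^ c * l₀ := by push_cast; rw [← h5k]; push_cast; ring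
    _ ≤ (B * Real.log (1 / ε)) ^ c * ((l₀ : ℝ) + 1) := by
        exact mul_le_mul (Real.rpow_le_rpow (by positivity) hx hcpos.le) (by linarith)
          (by positivity) (Real.rpow_nonneg (by positivity) _)
    _ = ((l₀ : ℝ) + 1) * B ^ c * Real.log (1 / ε) ^ c := by
        rw [Real.mul_rpow hB0.le hlogε0.le]; ring

end Literature.Computability.QuantumComplexity.SolovayKitaev
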